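import Literature.IUT.HodgeTheaters.BadLocalFrobenioidOfKitsDTheta
import Literature.AnabelianGeometry.SemiGraphs.TemperedCurveDeltaCharacteristic
import HarnessLib

/-!
# [IUTchI] Example 3.2 (vi)(a)(b) AT THE GENUINE BAD DATUM with the anabelian binder `hΔ` in the cell's (H1) currency —
# «`Ker(Π_v̲ ↠ G_v̲)` is characteristic» for ANY [IUTchI] Ex. 3.2 group datum along a profinite completion, modulo ONE
# [AbsTopI] Thm 2.6 (v) regime BY NAME (proofs only)

S. Mochizuki, *Inter-universal Teichmüller theory I*, kurims manuscript (May 2020), Example 3.2 (vi) p. 73 («(a) … a functorial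
algorithm for reconstructing the subcategory `𝒟⊢_v ⊆ 𝒟_v` from the category `𝒟_v` [cf. [AbsAnab], Lemma 1.3.8]; (b) … the category
`𝒟^Θ_v` from the category `𝒟_v` [cf., e.g., [EtTh], Proposition 2.4]») ([IUTchI] Ex 3.2 (vi) p.73) [claim: Mochizuki2012, status: disputed]
(D-0012 claim key, series status DISPUTED — compositions BY NAME over landed files; nothing of the series is asserted; no side is taken on
[IUTchIII] Cor. 3.12); S. Mochizuki, *Semi-graphs of anabelioids*, Publ. RIMS **42** (2006) [SemiAnbd], §6 p. 69 («we shall denote the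
profinite completion by means of a "∧"») [cite: MochizukiSemiAnbd2006, §6 p.69]; *The Absolute Anabelian Geometry of Hyperbolic Curves* (2004)
[AbsAnab], Lemma 1.3.8 p. 18 [cite: MochizukiAbsAnab2004, Lemma 1.3.8 p.18]; *Topics in Absolute Anabelian Geometry I* (2012) [AbsTopI],
Thm 2.6 (v) p. 22 («the kernel of `Π ↠ G` may be characterized group-theoretically») [cite: MochizukiAbsTopI2012, Thm 2.6 (v) p.22].

PURPOSE (abc-iut-L5-lead TOKEN EDIT v2.10, Ex. 3.2 (vi) sub-ledger «each binder FACT-by-name / ORIGIN / discharged»).  abc-iut-L5-t2's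
genuine-datum closers `InitialThetaData.ddashFromD_badLocalFrobenioidAt_of_forall_map_ker` (★ p489141) /
`dThetaFromD_badLocalFrobenioidAt_of_forall_map_ker` (★ p491087) — and their [EtTh] §1 instances `…AtDoubleUnderline_of_forall_map_ker` at
`Π_v̲ := Π^tp_{X̲̲}` — display the [AbsAnab] Lemma 1.3.8 binder in unfolded F-0007 shape for a TEMPERED group:
`hΔ : ∀ φ : Π_v̲ ≃ₜ* Π_v̲, Ker(Π_v̲ ↠ G_v̲).map φ = Ker(Π_v̲ ↠ G_v̲)`.
THIS PROOF-ONLY FILE (no `def`, no `instance`, no named fact) DERIVES that binder for ANY group datum `T : BadLocalGroupDatum G Π_v̲`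
([IUTchI] Ex. 3.2 (i)/(v): `aug : Π_v̲ ↠ G_v̲` continuous open, `Π_Ÿ ⊆ Π_v̲` open onto `G_v̲`) in the (H1) currency of record of the cell
(abc-iut-L3 `TemperedCurve.isTopCharacteristic_deltaTemp_of_regime`, abc-iut-w5-d233 / abc-iut-w6-d053 for the [IUTchII] §1 settings) —
the [SemiAnbd] §6 reduction along a profinite completion + ONE [AbsTopI] Thm 2.6 (v) regime — WITHOUT the [IUTchII] §1 setting's extra data
(cyclotome, `l` odd prime, `p ≠ 2`, `4l`-th roots, theta cocycle) that the route through `ThetaSetting.ofDoubleUnderline` carries: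
* `BadLocalGroupDatum.ker_aug_eq_comap_of_compatible` — for a COMPATIBLE completion package (`ι : Π_v̲ → Π_E`, `g : G_v̲ → G_E` injective,
  `aug_E ∘ ι = g ∘ aug`): `Ker(aug) = ι⁻¹(Δ_E)`;
* `BadLocalGroupDatum.forall_map_ker_aug_of_completion_isTopCharacteristic` — `hΔ` from «`Δ_E ⊆ Π_E` characteristic» along a profinite
  completion `ι` (abc-iut-L3 `IsProfiniteCompletion.isTopCharacteristic_comap`: automorphisms extend by the universal property);
  `…_of_completion_preservesGeom` ([AbsAnab] Lemma 1.3.8 = F-0007 `PreservesGeom` BY NAME at the package), `…_of_completion_coinvariantRankConstant`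
  ([AbsTopI] Thm 2.6 (v): MLF base data, `Δ_E` tfg, F-0001 `CoinvariantRankConstant` BY NAME — kernel theorem
  `preservesGeom_of_coinvariantRankConstant`), `…_of_completion_starCondition` ([AbsAnab] Lemma 1.1.4 (ii) as printed: F-0011 + tfg + F-0012);
* `BadLocalGroupDatum.exists_completion_package` — NON-VACUITY, hypothesis-free: EVERY group datum over `G_v̲ = Gal(k̄/k)`, `k` finite over
  `ℚ_p`, on a topological group `Π_v̲` admits a compatible completion package WITH MLF base data (`Π_E :=` the profinite completion of `Π_v̲`,
  abc-iut-L2-d1 `IsProfiniteCompletion.exists_isProfiniteCompletion`; `G_E := Gal(k̄/k)`, `g = id`; `aug_E :=` the extension of `aug` along the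
  completion, `IsProfiniteCompletion.exists_extension`, surjective because `aug` is);
* `BadLocalGroupDatum.forall_map_ker_aug_of_regime` / `_of_exists_package` — the usable forms: `hΔ` modulo ONE Thm 2.6 (v) regime hypothesis
  on the compatible MLF completion packages of `Π_v̲`, resp. from ONE package in the regime;
* `BadLocalGroupDatum.forall_exists_conj_Y_of_isTopCharacteristic` — the (vi)(b) binder `hY` («`φ(Π_Ÿ)` is a conjugate of `Π_Ÿ`») from
  «`Π_Ÿ ⊆ Π_v̲` characteristic» (abc-iut-L2's `IsTopCharacteristic`, [EtTh] Def. 3.3 / Prop. 2.4 currency; conjugator `1`);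
* cone read-outs at abc-iut-L5-t2's GENUINE datum `badLocalFrobenioidAt` (`K_v̲ = K_w`, `G_v̲ = Gal(K̄_w/K_w)` — `rfl`-Mathlib's
  `absoluteGaloisGroup`, genuine `q_v̲`, `q̲_v̲`, `𝒞⊢_v̲`; every `T`, every tempered-side input `Kt`):
  `InitialThetaData.ddashFromD_badLocalFrobenioidAt_of_regime` ((a)), `dThetaFromD_badLocalFrobenioidAt_of_regime` ((b), + `hY`), and AT THE
  [EtTh] §1 OBJECTS `Π_v̲ := Π^tp_{X̲̲}` (`badLocalFrobenioidAtDoubleUnderline`, ★ p454048): `…AtDoubleUnderline_of_regime`,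
  `…AtDoubleUnderline_of_completion_preservesGeom`, `dThetaFromD_…AtDoubleUnderline_of_regime_of_isTopCharacteristic` (`hY` := «`Π^tp_{Ÿ̲̲}`
  characteristic»), `ex32vi_ab_badLocalFrobenioidAtDoubleUnderline_of_regime`, and NON-VACUITY `exists_completion_package_badGroupDatumOfDoubleUnderline`.
BINDER CENSUS at the [EtTh] §1 objects after this file: (a) {`dGL` (abc-iut-L3 group-level bundle), `hS2`, `C`, `ι`, `Kt`, `hreg` = F-0001 regime
BY NAME on the compatible MLF completion packages of `Π^tp_{X̲̲}` (packages EXIST)}; (b) the same ∪ {«`Π^tp_{Ÿ̲̲} ⊆ Π^tp_{X̲̲}` characteristic»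
([EtTh] Prop. 2.4-class, abc-iut-L2 currency)} — NO unfolded Lemma 1.3.8 binder.
HONEST FRAMING: the reduction is unconditional topological-group theory; the regime hypothesis is print's input at this point ([AbsTopI] Prop 2.2:
`Δ` tfg; the rank computation of [AbsAnab] Lemma 1.1.4 (ii)) for the profinite `Π_{X̲̲_K}`, supplied in print by the geometry of the curve and
displayed BY NAME here; [SemiAnbd]/[AbsAnab]/[AbsTopI] are refereed and undisputed; no curve, no [EtTh] §1 theta setting, no initial Θ-datum is
asserted to exist; no Ex. 3.2 (i) token; no instance, no notation, no `sorry`; typed ≠ inhabited ≠ proved; nothing here asserts abc proved or refuted.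
-/

noncomputable section

namespace Literature.IUT.HodgeTheaters

open CategoryTheory Literature.AnabelianGeometry.AbsoluteAnabelian Literature.AnabelianGeometry.SemiGraphs
  Literature.AnabelianGeometry.EtaleTheta Literature.NumberTheory.NumberFields _root_.IsDedekindDomain _root_.NumberField
  Topology

/-! ### §1 «`Ker(Π_v̲ ↠ G_v̲)` characteristic» for a group datum along a compatible profinite completion -/

namespace BadLocalGroupDatum

section Generic

variable {G : Type} [Group G] [TopologicalSpace G] {P : Type} [Group P] [TopologicalSpace P] (T : BadLocalGroupDatum G P)

/-- **`Ker(aug) = ι⁻¹(Δ_E)` for a compatible completion package**: if `ι : Π_v̲ → Π_E` and an INJECTIVE `g : G_v̲ → G_E` satisfy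
`aug_E ∘ ι = g ∘ aug`, then `Ker(Π_v̲ ↠ G_v̲) = ι⁻¹(Ker(Π_E ↠ G_E))` (abc-iut-w5-d233's `deltaX_eq_comap_of_aug_compatible`, for group data).
[cite: MochizukiSemiAnbd2006, §6 p.69] -/
theorem ker_aug_eq_comap_of_compatible (E : FundamentalExtension.{0}) (ι : P →ₜ* E.arith) (g : G →* E.gal)
    (hg : Function.Injective g) (h : ∀ x, E.aug (ι x) = g (T.aug x)) : T.aug.ker = E.geom.comap ι.toMonoidHom := by
  ext x
  rw [Subgroup.mem_comap, MonoidHom.mem_ker, FundamentalExtension.mem_geom]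
  change T.aug x = 1 ↔ E.aug (ι x) = 1
  rw [h]
  constructor
  · intro hx
    rw [hx, map_one]
  · intro hx
    exact hg (by rw [hx, map_one])

/-- **`hΔ` along a profinite completion**: if `ι : Π_v̲ → Π_E` is a profinite completion ([SemiAnbd] §6) compatible with the augmentations
(`g` injective) and `Δ_E ⊆ Π_E` is carried onto itself by EVERY automorphism of topological groups of `Π_E`, then every bicontinuous
automorphism of `Π_v̲` carries `Ker(Π_v̲ ↠ G_v̲)` onto itself (abc-iut-L3 `IsProfiniteCompletion.isTopCharacteristic_comap`: automorphisms of `Π_v̲`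
extend to `Π_E` by the universal property). [cite: MochizukiSemiAnbd2006, §6 p.69] -/
theorem forall_map_ker_aug_of_completion_isTopCharacteristic (E : FundamentalExtension.{0}) (ι : P →ₜ* E.arith)
    (hι : IsProfiniteCompletion ι) (g : G →* E.gal) (hg : Function.Injective g) (h : ∀ x, E.aug (ι x) = g (T.aug x))
    (hchar : IsTopCharacteristic E.arith E.geom) (φ : P ≃ₜ* P) :
    T.aug.ker.map φ.toMulEquiv.toMonoidHom = T.aug.ker := by
  rw [T.ker_aug_eq_comap_of_compatible E ι g hg h]
  exact hι.isTopCharacteristic_comap hchar φ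

/-- **`hΔ` from [AbsAnab] Lemma 1.3.8 BY NAME at a compatible completion package** (F-0007 `PreservesGeom` for every self-isomorphism of `Π_E`,
the admissible «at named instance» form). [cite: MochizukiAbsAnab2004, Lemma 1.3.8 p.18] -/
theorem forall_map_ker_aug_of_completion_preservesGeom (E : FundamentalExtension.{0}) (ι : P →ₜ* E.arith)
    (hι : IsProfiniteCompletion ι) (g : G →* E.gal) (hg : Function.Injective g) (h : ∀ x, E.aug (ι x) = g (T.aug x))
    (h138 : ∀ α : E.arith ≃ₜ* E.arith, FundamentalExtension.PreservesGeom α) (φ : P ≃ₜ* P) :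
    T.aug.ker.map φ.toMulEquiv.toMonoidHom = T.aug.ker :=
  T.forall_map_ker_aug_of_completion_isTopCharacteristic E ι hι g hg h (fun α => h138 α) φ

/-- **`hΔ` in the [AbsTopI] Thm 2.6 (v) regime at a compatible completion package WITH MLF BASE DATA**: `Δ_E` topologically finitely generated
and `δ¹_l(Π″) − δ¹_l(G″)` independent of `l` (F-0001 `CoinvariantRankConstant` BY NAME) — Lemma 1.3.8 is then the kernel theorem
`preservesGeom_of_coinvariantRankConstant`. [cite: MochizukiAbsTopI2012, Thm 2.6 (v) p.22] -/
theorem forall_map_ker_aug_of_completion_coinvariantRankConstant (E : FundamentalExtension.{0}) (B : E.MLFBase)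
    (hΔE : IsTopologicallyFinitelyGenerated E.geom) (hc : E.CoinvariantRankConstant) (ι : P →ₜ* E.arith)
    (hι : IsProfiniteCompletion ι) (g : G →* E.gal) (hg : Function.Injective g) (h : ∀ x, E.aug (ι x) = g (T.aug x))
    (φ : P ≃ₜ* P) : T.aug.ker.map φ.toMulEquiv.toMonoidHom = T.aug.ker :=
  T.forall_map_ker_aug_of_completion_preservesGeom E ι hι g hg h
    (fun α => FundamentalExtension.preservesGeom_of_coinvariantRankConstant B B hΔE hc hΔE hc α) φ

/-- **`hΔ` in the regime of [AbsAnab] Lemma 1.1.4 (ii) as printed** at a compatible MLF completion package: splitting over an open subgroup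
of `G_E` (F-0011), `Δ_E` tfg, condition (∗) (F-0012) — kernel theorem `preservesGeom_of_starCondition`. [cite: MochizukiAbsAnab2004, Lemma 1.3.8 p.18] -/
theorem forall_map_ker_aug_of_completion_starCondition (E : FundamentalExtension.{0}) (B : E.MLFBase)
    (hs : E.SplitsOverOpenSubgroup) (hΔE : IsTopologicallyFinitelyGenerated E.geom) (hstar : E.StarCondition)
    (ι : P →ₜ* E.arith) (hι : IsProfiniteCompletion ι) (g : G →* E.gal) (hg : Function.Injective g)
    (h : ∀ x, E.aug (ι x) = g (T.aug x)) (φ : P ≃ₜ* P) : T.aug.ker.map φ.toMulEquiv.toMonoidHom = T.aug.ker :=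
  T.forall_map_ker_aug_of_completion_preservesGeom E ι hι g hg h
    (fun α => FundamentalExtension.preservesGeom_of_starCondition B B hs hΔE hstar hs hΔE hstar α) φ

/-- **The (vi)(b) binder `hY` from «`Π_Ÿ ⊆ Π_v̲` characteristic»**: if every bicontinuous automorphism `φ` of `Π_v̲` carries `Π_Ÿ` onto itself
(abc-iut-L2's `IsTopCharacteristic`), then `φ(Π_Ÿ)` is a conjugate of `Π_Ÿ` — by the conjugator `1`. [cite: MochizukiEtTh2009, Def 3.3 p.72] -/
theorem forall_exists_conj_Y_of_isTopCharacteristic (hK : IsTopCharacteristic P T.Y.toSubgroup) (φ : P ≃ₜ* P) :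
    ∃ c : P, ∀ g : P, g ∈ T.Y ↔ c⁻¹ * φ g * c ∈ T.Y := by
  refine ⟨1, fun g => ?_⟩
  rw [inv_one, one_mul, mul_one]
  have hmem : φ g ∈ T.Y.toSubgroup.map φ.toMulEquiv.toMonoidHom ↔ g ∈ T.Y.toSubgroup := by
    rw [Subgroup.mem_map_equiv]
    exact Iff.of_eq (congrArg (· ∈ T.Y.toSubgroup) (φ.toMulEquiv.symm_apply_apply g))
  rw [hK φ] at hmem
  exact ⟨fun hg => (hmem.2 hg), fun hg => hmem.1 hg⟩

end Generic

/-! ### NON-VACUITY: every group datum over `Gal(k̄/k)` has a compatible MLF completion package; the regime forms -/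

section Package

variable {k : Type} [Field k] (p : ℕ) [Fact p.Prime] [Algebra ℚ_[p] k] [FiniteDimensional ℚ_[p] k]
  {P : Type} [Group P] [TopologicalSpace P] [IsTopologicalGroup P] (T : BadLocalGroupDatum (Field.absoluteGaloisGroup k) P)

include p in
/-- **The compatible completion package EXISTS for every group datum `Π_v̲ ↠ Gal(k̄/k)`, `k` finite over `ℚ_p`** — hypothesis-free:
`Π_E :=` the profinite completion of the topological group `Π_v̲` ([SemiAnbd] §6 p. 69, abc-iut `IsProfiniteCompletion.exists_isProfiniteCompletion`),
`G_E := Gal(k̄/k)` (`g = id`), `aug_E :=` the continuous extension of `aug` along the completion (universal property, `exists_extension`;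
surjective because `aug` is, [IUTchI] Ex. 3.2 (v)), MLF base data `(p, k, id)`. [cite: MochizukiSemiAnbd2006, §6 p.69] -/
theorem exists_completion_package :
    ∃ (E : FundamentalExtension.{0}) (_ : E.MLFBase) (ι : P →ₜ* E.arith) (g : Field.absoluteGaloisGroup k →* E.gal),
      IsProfiniteCompletion ι ∧ Function.Injective g ∧ ∀ x, E.aug (ι x) = g (T.aug x) := by
  haveI : CharZero k := charZero_of_injective_algebraMap (algebraMap ℚ_[p] k).injective
  obtain ⟨Phat, ι, hι⟩ := IsProfiniteCompletion.exists_isProfiniteCompletion P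
  let ψ : P →ₜ* absoluteGaloisGrp k := ⟨T.aug, T.continuous_aug⟩
  obtain ⟨Φ, hΦ⟩ := hι.exists_extension ψ
  have hsurj : Function.Surjective Φ := by
    intro y
    obtain ⟨x, hx⟩ := T.surjective_aug y
    exact ⟨ι x, by rw [hΦ]; exact hx⟩
  let E : FundamentalExtension.{0} :=
    { arith := Phat
      gal := absoluteGaloisGrp k
      aug := Φ
      aug_surjective := hsurj }
  refine ⟨E, { p := p, K := k, galIso := ContinuousMulEquiv.refl _ }, ι, MonoidHom.id _, hι,
    Function.injective_id, fun x => ?_⟩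
  change Φ (ι x) = T.aug x
  exact hΦ x

include p in
/-- **`hΔ` for a group datum over `Gal(k̄/k)` modulo ONE [AbsTopI] Thm 2.6 (v) regime hypothesis** on its compatible MLF completion packages
(`Δ_E` topologically finitely generated + F-0001 `CoinvariantRankConstant`, BY NAME; print: [AbsTopI] Prop 2.2 and the rank computation of
[AbsAnab] Lemma 1.1.4 (ii) for the profinite `Π_{X_K}`) — the package itself is supplied by `exists_completion_package`.
[cite: MochizukiAbsTopI2012, Thm 2.6 (v) p.22] -/
theorem forall_map_ker_aug_of_regime
    (hreg : ∀ (E : FundamentalExtension.{0}) (_ : E.MLFBase) (ι : P →ₜ* E.arith) (g : Field.absoluteGaloisGroup k →* E.gal),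
      IsProfiniteCompletion ι → Function.Injective g → (∀ x, E.aug (ι x) = g (T.aug x)) →
        IsTopologicallyFinitelyGenerated E.geom ∧ E.CoinvariantRankConstant)
    (φ : P ≃ₜ* P) : T.aug.ker.map φ.toMulEquiv.toMonoidHom = T.aug.ker := by
  obtain ⟨E, B, ι, g, hι, hg, h⟩ := T.exists_completion_package p
  obtain ⟨hΔE, hc⟩ := hreg E B ι g hι hg h
  exact T.forall_map_ker_aug_of_completion_coinvariantRankConstant E B hΔE hc ι hι g hg h φ

omit [IsTopologicalGroup P] in
/-- **`hΔ` from the EXISTENCE of one compatible MLF completion package in the [AbsTopI] Thm 2.6 (v) regime** (the usable form: a consumer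
supplies ONE package with `Δ_E` tfg and `CoinvariantRankConstant`, F-0001 BY NAME at the instance). [cite: MochizukiAbsTopI2012, Thm 2.6 (v) p.22] -/
theorem forall_map_ker_aug_of_exists_package
    (hex : ∃ (E : FundamentalExtension.{0}) (_ : E.MLFBase) (ι : P →ₜ* E.arith) (g : Field.absoluteGaloisGroup k →* E.gal),
      IsProfiniteCompletion ι ∧ Function.Injective g ∧ (∀ x, E.aug (ι x) = g (T.aug x)) ∧
        IsTopologicallyFinitelyGenerated E.geom ∧ E.CoinvariantRankConstant)
    (φ : P ≃ₜ* P) : T.aug.ker.map φ.toMulEquiv.toMonoidHom = T.aug.ker := by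
  obtain ⟨E, B, ι, g, hι, hg, h, hΔE, hc⟩ := hex
  exact T.forall_map_ker_aug_of_completion_coinvariantRankConstant E B hΔE hc ι hι g hg h φ

end Package

end BadLocalGroupDatum

/-! ### §2 [IUTchI] Example 3.2 (vi)(a)(b) at the genuine datum of the initial Θ-data, `hΔ` in the regime currency -/

section Datum

variable {F K Fbar : Type} [Field F] [NumberField F] [Field K] [NumberField K] [Algebra F K]
  [Field Fbar] [Algebra F Fbar] [Algebra K Fbar] [IsScalarTower F K Fbar] {E : WeierstrassCurve F}
  [E.IsElliptic] {l : ℕ} {Pb : BadPlacePredicates K} (D : InitialThetaData F K Fbar E l Pb)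
  {v : FinitePlace F} (hv : v ∈ D.VFbad) (w : HeightOneSpectrum (𝓞 K)) [w.asIdeal.LiesOver v.maximalIdeal.asIdeal]
  (p : ℕ) [Fact p.Prime] (hw : ((p : ℕ) : 𝓞 K) ∈ w.asIdeal)

namespace InitialThetaData

/-- **[IUTchI] Ex. 3.2 (vi) (a) AT THE GENUINE DATUM** `badLocalFrobenioidAt` (`K_v̲ = K_w`, `G_v̲ = Gal(K̄_w/K_w)`, genuine `q_v̲`, `q̲_v̲`, `𝒞⊢_v̲`),
for EVERY group datum on a TEMPERED Galois-countable `Π_v̲` and EVERY tempered-side input `Kt`, **modulo ONE [AbsTopI] Thm 2.6 (v) regime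
hypothesis BY NAME** on the compatible MLF completion packages of `Π_v̲` (packages EXIST: `BadLocalGroupDatum.exists_completion_package`):
`𝒟⊢_v̲ ⊆ 𝒟_v̲` is reconstructible category-theoretically from `𝒟_v̲` — ★ p489141's unfolded Lemma 1.3.8 binder `hΔ` DERIVED.
([IUTchI] Ex 3.2 (vi) (a) p.73) [claim: Mochizuki2012, status: disputed] -/
theorem ddashFromD_badLocalFrobenioidAt_of_regime {P : Type} [Group P] [TopologicalSpace P]
    [IsTopologicalGroup P] [SecondCountableTopology P]
    (T : BadLocalGroupDatum (GaloisValDatum.ofPlace K p w hw).Gal P) {Fv : Type} [Category.{0} Fv] {Fbirat : Type}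
    [Category.{0} Fbirat] {Cv : Type} [Category.{0} Cv]
    (Kt : TemperedThetaInput (GaloisValDatum.ofPlace K p w hw) T (D.qRootAt_not_isUnit hv w p hw) Fv Fbirat Cv)
    (hP : IsTempered P)
    (hreg : ∀ (E : FundamentalExtension.{0}) (_ : E.MLFBase) (ι : P →ₜ* E.arith)
      (g : (GaloisValDatum.ofPlace K p w hw).Gal →* E.gal),
      IsProfiniteCompletion ι → Function.Injective g → (∀ x, E.aug (ι x) = g (T.aug x)) →
        IsTopologicallyFinitelyGenerated E.geom ∧ E.CoinvariantRankConstant) :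
    (D.badLocalFrobenioidAt hv w p hw T Kt).DdashFromD :=
  haveI := GaloisValDatum.finiteDimensional_rescaledCompletion K p w hw
  D.ddashFromD_badLocalFrobenioidAt_of_forall_map_ker hv w p hw T Kt hP
    (BadLocalGroupDatum.forall_map_ker_aug_of_regime (k := RescaledCompletion K p w hw) p T hreg)

/-- **[IUTchI] Ex. 3.2 (vi) (b) AT THE GENUINE DATUM** for every group datum on a tempered Galois-countable `Π_v̲` and every `Kt`, modulo the
Thm 2.6 (v) regime hypothesis BY NAME (as in (a)) and the [EtTh] Prop. 2.4-class binder `hY` (invariance of `Π_Ÿ` up to conjugacy):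
`𝒟^Θ_v̲` is reconstructible category-theoretically from `𝒟_v̲`. ([IUTchI] Ex 3.2 (vi) (b) p.73) [claim: Mochizuki2012, status: disputed] -/
theorem dThetaFromD_badLocalFrobenioidAt_of_regime {P : Type} [Group P] [TopologicalSpace P]
    [IsTopologicalGroup P] [SecondCountableTopology P]
    (T : BadLocalGroupDatum (GaloisValDatum.ofPlace K p w hw).Gal P) {Fv : Type} [Category.{0} Fv] {Fbirat : Type}
    [Category.{0} Fbirat] {Cv : Type} [Category.{0} Cv]
    (Kt : TemperedThetaInput (GaloisValDatum.ofPlace K p w hw) T (D.qRootAt_not_isUnit hv w p hw) Fv Fbirat Cv)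
    (hP : IsTempered P)
    (hreg : ∀ (E : FundamentalExtension.{0}) (_ : E.MLFBase) (ι : P →ₜ* E.arith)
      (g : (GaloisValDatum.ofPlace K p w hw).Gal →* E.gal),
      IsProfiniteCompletion ι → Function.Injective g → (∀ x, E.aug (ι x) = g (T.aug x)) →
        IsTopologicallyFinitelyGenerated E.geom ∧ E.CoinvariantRankConstant)
    (hY : ∀ φ : P ≃ₜ* P, ∃ c : P, ∀ g : P, g ∈ T.Y ↔ c⁻¹ * φ g * c ∈ T.Y) :
    (D.badLocalFrobenioidAt hv w p hw T Kt).DThetaFromD :=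
  haveI := GaloisValDatum.finiteDimensional_rescaledCompletion K p w hw
  D.dThetaFromD_badLocalFrobenioidAt_of_forall_map_ker hv w p hw T Kt hP
    (BadLocalGroupDatum.forall_map_ker_aug_of_regime (k := RescaledCompletion K p w hw) p T hreg) hY

/-! ### At the [EtTh] §1 objects: `Π_v̲ := Π^tp_{X̲̲}` of the double-underline curve -/

variable {S : ThetaSetting p} {ES : S.EtaleThetaData} (dGL : S.toTemperedCurve.GroupLevelData) (hS2 : S.Sec2Hyps)
  (C : ES.DoubleUnderline l) (ι : ↥S.GK ≃ₜ* (GaloisValDatum.ofPlace K p w hw).Gal)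
  {Fv : Type} [Category.{0} Fv] {Fbirat : Type} [Category.{0} Fbirat] {Cv : Type} [Category.{0} Cv]
  (Kt : TemperedThetaInput (GaloisValDatum.ofPlace K p w hw) (badGroupDatumOfDoubleUnderline w p hw dGL hS2 C ι)
    (D.qRootAt_not_isUnit hv w p hw) Fv Fbirat Cv)

/-- **NON-VACUITY at the [EtTh] §1 objects**: the GENUINE group datum `Π^tp_{X̲̲} ↠ Gal(K̄_w/K_w)` (abc-iut-L5-t2 ★ p454048
`badGroupDatumOfDoubleUnderline`, over abc-iut-L2-t7's junction) admits a compatible completion package with MLF base data `(p, K_w, id)` —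
`Π_E :=` the profinite completion of `Π^tp_{X̲̲}` ([SemiAnbd] §6). [cite: MochizukiSemiAnbd2006, §6 p.69] -/
theorem exists_completion_package_badGroupDatumOfDoubleUnderline :
    ∃ (E : FundamentalExtension.{0}) (_ : E.MLFBase) (j : ↥C.Huu →ₜ* E.arith)
      (g : (GaloisValDatum.ofPlace K p w hw).Gal →* E.gal),
      IsProfiniteCompletion j ∧ Function.Injective g ∧
        ∀ x, E.aug (j x) = g ((badGroupDatumOfDoubleUnderline w p hw dGL hS2 C ι).aug x) :=
  haveI := GaloisValDatum.finiteDimensional_rescaledCompletion K p w hw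
  BadLocalGroupDatum.exists_completion_package (k := RescaledCompletion K p w hw) p
    (badGroupDatumOfDoubleUnderline w p hw dGL hS2 C ι)

/-- **[IUTchI] Ex. 3.2 (vi) (a) AT THE GENUINE DATUM over the GENUINE [EtTh] §1 group datum, `hΔ` DERIVED** (`Π_v̲ := Π^tp_{X̲̲}`; tempered and
Galois-countable are THEOREMS from abc-iut-L3's group-level bundle `dGL`): modulo ONE [AbsTopI] Thm 2.6 (v) regime hypothesis BY NAME on the
compatible MLF completion packages of `Π^tp_{X̲̲}` (F-0001 `CoinvariantRankConstant` + `Δ_E` tfg; packages EXIST,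
`exists_completion_package_badGroupDatumOfDoubleUnderline`), `𝒟⊢_v̲ ⊆ 𝒟_v̲ = 𝓑^temp(X̲̲_v̲)⁰` is reconstructible from `𝒟_v̲` — the unfolded
Lemma 1.3.8 binder of ★ p489141 `…AtDoubleUnderline_of_forall_map_ker` is GONE. ([IUTchI] Ex 3.2 (vi) (a) p.73) [claim: Mochizuki2012, status: disputed] -/
theorem ddashFromD_badLocalFrobenioidAtDoubleUnderline_of_regime
    (hreg : ∀ (E : FundamentalExtension.{0}) (_ : E.MLFBase) (j : ↥C.Huu →ₜ* E.arith)
      (g : (GaloisValDatum.ofPlace K p w hw).Gal →* E.gal),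
      IsProfiniteCompletion j → Function.Injective g →
        (∀ x, E.aug (j x) = g ((badGroupDatumOfDoubleUnderline w p hw dGL hS2 C ι).aug x)) →
        IsTopologicallyFinitelyGenerated E.geom ∧ E.CoinvariantRankConstant) :
    (D.badLocalFrobenioidAtDoubleUnderline hv w p hw dGL hS2 C ι Kt).DdashFromD :=
  haveI := BadLocalGroupDatum.secondCountableTopology_Huu dGL C
  D.ddashFromD_badLocalFrobenioidAt_of_regime hv w p hw _ Kt (BadLocalGroupDatum.isTempered_Huu dGL C) hreg

/-- **(vi)(a) at the [EtTh] §1 objects from [AbsAnab] Lemma 1.3.8 BY NAME AT A COMPATIBLE COMPLETION PACKAGE of `Π^tp_{X̲̲}`** (F-0007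
`PreservesGeom` for every self-isomorphism of `Π_E`; `j` a profinite completion, `aug_E ∘ j = g ∘ aug`, `g` injective — such packages EXIST).
([IUTchI] Ex 3.2 (vi) (a) p.73) [claim: Mochizuki2012, status: disputed] -/
theorem ddashFromD_badLocalFrobenioidAtDoubleUnderline_of_completion_preservesGeom (E' : FundamentalExtension.{0})
    (j : ↥C.Huu →ₜ* E'.arith) (hj : IsProfiniteCompletion j) (g : (GaloisValDatum.ofPlace K p w hw).Gal →* E'.gal)
    (hg : Function.Injective g) (h : ∀ x, E'.aug (j x) = g ((badGroupDatumOfDoubleUnderline w p hw dGL hS2 C ι).aug x))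
    (h138 : ∀ α : E'.arith ≃ₜ* E'.arith, FundamentalExtension.PreservesGeom α) :
    (D.badLocalFrobenioidAtDoubleUnderline hv w p hw dGL hS2 C ι Kt).DdashFromD :=
  haveI := BadLocalGroupDatum.secondCountableTopology_Huu dGL C
  D.ddashFromD_badLocalFrobenioidAt_of_forall_map_ker hv w p hw _ Kt (BadLocalGroupDatum.isTempered_Huu dGL C)
    ((badGroupDatumOfDoubleUnderline w p hw dGL hS2 C ι).forall_map_ker_aug_of_completion_preservesGeom E' j hj g hg h h138)

/-- **[IUTchI] Ex. 3.2 (vi) (b) AT THE GENUINE DATUM over the GENUINE [EtTh] §1 group datum, `hΔ` DERIVED**: modulo the Thm 2.6 (v) regime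
hypothesis BY NAME on the packages of `Π^tp_{X̲̲}` and the [EtTh] Prop. 2.4-class binder `hY` («`Π^tp_{Ÿ̲̲}` is carried onto a conjugate of itself
by every bicontinuous automorphism of `Π^tp_{X̲̲}`»), `𝒟^Θ_v̲` is reconstructible from `𝒟_v̲`.
([IUTchI] Ex 3.2 (vi) (b) p.73) [claim: Mochizuki2012, status: disputed] -/
theorem dThetaFromD_badLocalFrobenioidAtDoubleUnderline_of_regime
    (hreg : ∀ (E : FundamentalExtension.{0}) (_ : E.MLFBase) (j : ↥C.Huu →ₜ* E.arith)
      (g : (GaloisValDatum.ofPlace K p w hw).Gal →* E.gal),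
      IsProfiniteCompletion j → Function.Injective g →
        (∀ x, E.aug (j x) = g ((badGroupDatumOfDoubleUnderline w p hw dGL hS2 C ι).aug x)) →
        IsTopologicallyFinitelyGenerated E.geom ∧ E.CoinvariantRankConstant)
    (hY : ∀ φ : ↥C.Huu ≃ₜ* ↥C.Huu, ∃ c : ↥C.Huu, ∀ g : ↥C.Huu,
      g ∈ BadLocalGroupDatum.Ydduu hS2 C ↔ c⁻¹ * φ g * c ∈ BadLocalGroupDatum.Ydduu hS2 C) :
    (D.badLocalFrobenioidAtDoubleUnderline hv w p hw dGL hS2 C ι Kt).DThetaFromD :=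
  haveI := BadLocalGroupDatum.secondCountableTopology_Huu dGL C
  D.dThetaFromD_badLocalFrobenioidAt_of_regime hv w p hw _ Kt (BadLocalGroupDatum.isTempered_Huu dGL C) hreg hY

/-- **(vi)(b) at the [EtTh] §1 objects with BOTH anabelian binders in the cell's by-name currencies**: the Thm 2.6 (v) regime on the packages of
`Π^tp_{X̲̲}` ((H1), F-0001) and «`Π^tp_{Ÿ̲̲} ⊆ Π^tp_{X̲̲}` characteristic» (abc-iut-L2's `IsTopCharacteristic`, [EtTh] Prop. 2.4 / Def. 3.3 currency).
([IUTchI] Ex 3.2 (vi) (b) p.73) [claim: Mochizuki2012, status: disputed] -/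
theorem dThetaFromD_badLocalFrobenioidAtDoubleUnderline_of_regime_of_isTopCharacteristic
    (hreg : ∀ (E : FundamentalExtension.{0}) (_ : E.MLFBase) (j : ↥C.Huu →ₜ* E.arith)
      (g : (GaloisValDatum.ofPlace K p w hw).Gal →* E.gal),
      IsProfiniteCompletion j → Function.Injective g →
        (∀ x, E.aug (j x) = g ((badGroupDatumOfDoubleUnderline w p hw dGL hS2 C ι).aug x)) →
        IsTopologicallyFinitelyGenerated E.geom ∧ E.CoinvariantRankConstant)
    (hK : IsTopCharacteristic ↥C.Huu (BadLocalGroupDatum.Ydduu hS2 C).toSubgroup) :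
    (D.badLocalFrobenioidAtDoubleUnderline hv w p hw dGL hS2 C ι Kt).DThetaFromD :=
  D.dThetaFromD_badLocalFrobenioidAtDoubleUnderline_of_regime hv w p hw dGL hS2 C ι Kt hreg
    ((badGroupDatumOfDoubleUnderline w p hw dGL hS2 C ι).forall_exists_conj_Y_of_isTopCharacteristic hK)

/-- **[IUTchI] Ex. 3.2 (vi) (a) ∧ (b) JOINTLY at the [EtTh] §1 objects**, modulo {the Thm 2.6 (v) regime BY NAME on the packages of `Π^tp_{X̲̲}`,
«`Π^tp_{Ÿ̲̲}` characteristic»} — NO unfolded Lemma 1.3.8 binder. ([IUTchI] Ex 3.2 (vi) p.73) [claim: Mochizuki2012, status: disputed] -/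
theorem ex32vi_ab_badLocalFrobenioidAtDoubleUnderline_of_regime
    (hreg : ∀ (E : FundamentalExtension.{0}) (_ : E.MLFBase) (j : ↥C.Huu →ₜ* E.arith)
      (g : (GaloisValDatum.ofPlace K p w hw).Gal →* E.gal),
      IsProfiniteCompletion j → Function.Injective g →
        (∀ x, E.aug (j x) = g ((badGroupDatumOfDoubleUnderline w p hw dGL hS2 C ι).aug x)) →
        IsTopologicallyFinitelyGenerated E.geom ∧ E.CoinvariantRankConstant)
    (hK : IsTopCharacteristic ↥C.Huu (BadLocalGroupDatum.Ydduu hS2 C).toSubgroup) :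
    (D.badLocalFrobenioidAtDoubleUnderline hv w p hw dGL hS2 C ι Kt).DdashFromD ∧
      (D.badLocalFrobenioidAtDoubleUnderline hv w p hw dGL hS2 C ι Kt).DThetaFromD :=
  ⟨D.ddashFromD_badLocalFrobenioidAtDoubleUnderline_of_regime hv w p hw dGL hS2 C ι Kt hreg,
    D.dThetaFromD_badLocalFrobenioidAtDoubleUnderline_of_regime_of_isTopCharacteristic hv w p hw dGL hS2 C ι Kt hreg hK⟩

end InitialThetaData

end Datum

end Literature.IUT.HodgeTheaters

end
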